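import Summits.KontsevichZagierPeriods.KontsevichZagierPeriods.Theorems.FermatIsogenyBetaLinearSectorQuartersStubQuarticBeta
import Summits.KontsevichZagierPeriods.KontsevichZagierPeriods.Theorems.FermatIsogenyBetaLinearSectorSixthsStubSexticHalf
import HarnessLib

/-!
# `BetaLinearSector` (stmt-KontsevichZagierPeriods-3897), line `fermat-sector-transport` — stub `stub_sexticRational_equivalent_beta`

Euler's reflection formula at `1/6` inside the Kontsevich–Zagier calculus of moves, step 1 of the
`π`-class of the LEVEL-6 rung (`a, b, a', b' ∈ ⅙ℤ`) of the crux `BetaLinearSector` (route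
FermatIsogeny): the Beta cell `[(0,1), x^{-5/6}(1-x)^{-1/6}]` (value `B(1/6,5/6) = Γ(1/6)Γ(5/6) = 2π`)
is made RATIONAL by ONE change of variables (rule (2)),
`x = φ(w) = w⁶/(w⁶ + (1-w)⁶)` from `(0,1)` onto `(0,1)` (strictly increasing, `φ(0) = 0`, `φ(1) = 1`).
With `Q(w) = w⁶ + (1-w)⁶ > 0`: `1 - φ(w) = (1-w)⁶/Q(w)`, `φ'(w) = 6w⁵(1-w)⁵/Q(w)²`, and the pull-back
identity on `(0,1)`

  `φ(w)^{-5/6} · (1-φ(w))^{-1/6} · φ'(w) = (Q^{5/6}/w⁵) · (Q^{1/6}/(1-w)) · 6w⁵(1-w)⁵/Q² = 6(1-w)⁴/Q(w)`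

(`sextic_subst_pullback`), whence `[(0,1), 6(1-w)⁴/(w⁶+(1-w)⁶)] ∼ [(0,1), x^{-5/6}(1-x)^{-1/6}]`
(`stub_sexticRational_equivalent_beta`). The structure is that of the quartic case
`Summit.KontsevichZagierPeriods.FermatIsogeny.BetaLinearSector.Quarters.stub_quarticRational_equivalent_beta`
(`FermatIsogenyBetaLinearSectorQuartersStubQuarticBeta.lean`), whose one-dimensional bookkeeping
(`isSemialgebraicFunOn_ratFun₁`, `image_fin_one`) and the packaging lemma
`of_sub_of_mem_changeOfVariablesRel_dimOne` are reused; the positivity `Q > 0` is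
`sexticHalf_den_pos` (step 2, `FermatIsogenyBetaLinearSectorSixthsStubSexticHalf.lean`). Both
representations are PINNED by their domain and their integrand on it.

References: M. Kontsevich, D. Zagier, *Periods* (2001), §1.2 rule (2); G. E. Andrews, R. Askey,
R. Roy, *Special Functions* (1999), Thm. 1.2.1 (Euler's reflection formula).
-/

noncomputable section

namespace Summit.KontsevichZagierPeriods.FermatIsogeny.BetaLinearSector.Sixths

open Set MeasureTheory
open MvPolynomial (aeval X C)
open Literature.NumberTheory.Transcendental
open Summit.KontsevichZagierPeriods.HermiteRigidity.CMTwistQuasiPeriodTransfer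
  (of_sub_of_mem_changeOfVariablesRel_dimOne image_fin_one)
open Summit.KontsevichZagierPeriods.KontsevichZagierPeriods.Theorems.GKZLevelThree
  (isSemialgebraicFunOn_ratFun₁)

/-! ## The substitution `x = w⁶/(w⁶ + (1-w)⁶)` -/

/-- The derivative of `φ(w) = w⁶/(w⁶ + (1-w)⁶)` is `6w⁵(1-w)⁵/(w⁶ + (1-w)⁶)²`. -/
theorem sextic_hasDerivAt_subst (w : ℝ) :
    HasDerivAt (fun w : ℝ => w ^ 6 / (w ^ 6 + (1 - w) ^ 6))
      (6 * w ^ 5 * (1 - w) ^ 5 / (w ^ 6 + (1 - w) ^ 6) ^ 2) w := by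
  have hq : (w ^ 6 + (1 - w) ^ 6) ≠ 0 := (sexticHalf_den_pos w).ne'
  have h1 : HasDerivAt (fun w : ℝ => w ^ 6) (6 * w ^ 5) w := by
    simpa using hasDerivAt_pow 6 w
  have h2 : HasDerivAt (fun w : ℝ => w ^ 6 + (1 - w) ^ 6) (6 * w ^ 5 - 6 * (1 - w) ^ 5) w := by
    have h := (hasDerivAt_pow 6 w).add (((hasDerivAt_id' w).const_sub (1:ℝ)).pow 6)
    exact h.congr_deriv (by push_cast; ring)
  exact (h1.div h2 hq).congr_deriv (by ring)

/-- `φ = w⁶/(w⁶ + (1-w)⁶)` is strictly increasing on `[0,1]`. -/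
theorem sextic_strictMonoOn_subst :
    StrictMonoOn (fun w : ℝ => w ^ 6 / (w ^ 6 + (1 - w) ^ 6)) (Icc 0 1) := by
  refine strictMonoOn_of_deriv_pos (convex_Icc 0 1) ?_ fun w hw => ?_
  · exact (continuousOn_id.pow 6).div (by fun_prop) fun w _ => (sexticHalf_den_pos w).ne'
  · rw [interior_Icc] at hw
    rw [(sextic_hasDerivAt_subst w).deriv]
    have h1 : 0 < w := hw.1
    have h2 : 0 < 1 - w := by linarith [hw.2]
    have h3 := sexticHalf_den_pos w
    positivity

/-- `φ` maps `(0,1)` onto `(0,1)` (`φ(0) = 0`, `φ(1) = 1`, intermediate values). -/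
theorem sextic_image_subst :
    (fun w : ℝ => w ^ 6 / (w ^ 6 + (1 - w) ^ 6)) '' Ioo 0 1 = Ioo 0 1 := by
  set φ : ℝ → ℝ := fun w => w ^ 6 / (w ^ 6 + (1 - w) ^ 6) with hφ
  have hφ0 : φ 0 = 0 := by simp [hφ]
  have hφ1 : φ 1 = 1 := by norm_num [hφ]
  have hcont : ContinuousOn φ (Icc 0 1) :=
    (continuousOn_id.pow 6).div (by fun_prop) fun w _ => (sexticHalf_den_pos w).ne'
  apply Subset.antisymm
  · rintro _ ⟨w, hw, rfl⟩
    have hm := sextic_strictMonoOn_subst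
    refine ⟨?_, ?_⟩
    · simpa [hφ0] using hm (left_mem_Icc.2 zero_le_one) (Ioo_subset_Icc_self hw) hw.1
    · simpa [hφ1] using hm (Ioo_subset_Icc_self hw) (right_mem_Icc.2 zero_le_one) hw.2
  · intro y hy
    obtain ⟨w, hw, hwy⟩ : y ∈ φ '' Icc 0 1 := by
      have := intermediate_value_Icc zero_le_one hcont
      rw [hφ0, hφ1] at this
      exact this (Ioo_subset_Icc_self hy)
    refine ⟨w, ⟨?_, ?_⟩, hwy⟩
    · rcases hw.1.lt_or_eq with h | h
      · exact h
      · exfalso; rw [← h, hφ0] at hwy; linarith [hy.1]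
    · rcases hw.2.lt_or_eq with h | h
      · exact h
      · exfalso; rw [h, hφ1] at hwy; linarith [hy.2]

/-- The pull-back identity of step 1: for `0 < w < 1`, `x = w⁶/Q`, `Q = w⁶ + (1-w)⁶`,
`x^{-5/6} (1-x)^{-1/6} · (6w⁵(1-w)⁵/Q²) = 6(1-w)⁴/Q`. -/
theorem sextic_subst_pullback {w : ℝ} (hw : w ∈ Ioo (0:ℝ) 1) :
    (w ^ 6 / (w ^ 6 + (1 - w) ^ 6)) ^ (-(5:ℝ) / 6) *
        (1 - w ^ 6 / (w ^ 6 + (1 - w) ^ 6)) ^ (-(1:ℝ) / 6) *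
        (6 * w ^ 5 * (1 - w) ^ 5 / (w ^ 6 + (1 - w) ^ 6) ^ 2) =
      6 * (1 - w) ^ 4 / (w ^ 6 + (1 - w) ^ 6) := by
  set q : ℝ := w ^ 6 + (1 - w) ^ 6 with hq
  have hq0 : 0 < q := sexticHalf_den_pos w
  have hw0 : 0 < w := hw.1
  have hw1 : 0 < 1 - w := by linarith [hw.2]
  have h6 : (6:ℕ) ≠ 0 := by norm_num
  -- `(w⁶/q)^{-5/6} = (q^{1/6})⁵/w⁵`
  have hA : (w ^ 6 / q) ^ (-(5:ℝ) / 6) = (q ^ ((6:ℕ)⁻¹ : ℝ)) ^ 5 / w ^ 5 := by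
    rw [show (-(5:ℝ) / 6) = -(((6:ℕ)⁻¹ : ℝ) * 5) by norm_num, Real.rpow_neg (by positivity),
      Real.div_rpow (by positivity) hq0.le, Real.rpow_mul (by positivity), Real.rpow_mul hq0.le,
      Real.pow_rpow_inv_natCast hw0.le h6, inv_div]
    norm_num
  -- `(1 - w⁶/q)^{-1/6} = q^{1/6}/(1-w)`
  have h1s : 1 - w ^ 6 / q = (1 - w) ^ 6 / q := by
    rw [eq_div_iff hq0.ne', sub_mul, div_mul_cancel₀ _ hq0.ne', hq]
    ring
  have hB : (1 - w ^ 6 / q) ^ (-(1:ℝ) / 6) = q ^ ((6:ℕ)⁻¹ : ℝ) / (1 - w) := by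
    rw [h1s, show (-(1:ℝ) / 6) = -((6:ℕ)⁻¹ : ℝ) by norm_num, Real.rpow_neg (by positivity),
      Real.div_rpow (by positivity) hq0.le, Real.pow_rpow_inv_natCast hw1.le h6, inv_div]
  -- `c = q^{1/6}`, `c⁶ = q`
  set c : ℝ := q ^ ((6:ℕ)⁻¹ : ℝ) with hc
  have hc6 : c ^ 6 = q := Real.rpow_inv_natCast_pow hq0.le h6
  have hc0 : c ≠ 0 := by
    intro h0
    rw [h0] at hc6
    norm_num at hc6
    exact hq0.ne' hc6.symm
  rw [hA, hB, ← hc6]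
  have hw0' : w ≠ 0 := hw0.ne'
  have hw1' : (1 - w) ≠ 0 := hw1.ne'
  field_simp

/-- **Step 1 (Euler's reflection at `1/6`).**
`[(0,1), 6(1-w)⁴/(w⁶+(1-w)⁶)] ∼ [(0,1), x^{-5/6}(1-x)^{-1/6}]` by ONE change of variables
`x = w⁶/(w⁶ + (1-w)⁶)` (rule (2)): `ℚ`-rational without pole, strictly increasing from `(0,1)` onto
`(0,1)`, with the pull-back identity `sextic_subst_pullback`. [cite: KontsevichZagier2001, §1.2 rule (2)] -/
theorem stub_sexticRational_equivalent_beta : ∀ (W β : KZ.IntegralRep 1), W.domain = {x | x 0 ∈ Set.Ioo (0:ℝ) 1} → Set.EqOn W.integrand (fun x => 6 * (1 - x 0) ^ 4 / ((x 0) ^ 6 + (1 - x 0) ^ 6)) W.domain → β.domain = {x | x 0 ∈ Set.Ioo (0:ℝ) 1} → Set.EqOn β.integrand (fun x => (x 0) ^ (-(5:ℝ) / 6) * (1 - x 0) ^ (-(1:ℝ) / 6)) β.domain → KZ.Equivalent W β := by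
  intro W β hWd hWi hβd hβi
  set φ : ℝ → ℝ := fun w => w ^ 6 / (w ^ 6 + (1 - w) ^ 6) with hφ
  set φ' : ℝ → ℝ := fun w => 6 * w ^ 5 * (1 - w) ^ 5 / (w ^ 6 + (1 - w) ^ 6) ^ 2 with hφ'
  have hmem : ∀ p ∈ W.domain, p 0 ∈ Ioo (0:ℝ) 1 := fun p hp => by rw [hWd] at hp; exact hp
  refine KZ.changeOfVariablesRel_subset_relations
    (of_sub_of_mem_changeOfVariablesRel_dimOne W β φ φ' ?_
      (fun p _ => sextic_hasDerivAt_subst (p 0)) ?_ ?_ ?_)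
  · -- semialgebraic: `w⁶/(w⁶ + (1-w)⁶)`, a `ℚ`-rational function without real pole
    refine isSemialgebraicFunOn_ratFun₁ W.isSemialgebraic_domain (X 0 ^ 6)
      (X 0 ^ 6 + (1 - X 0) ^ 6) φ (fun x _ => ?_) (fun x _ => ?_)
    · simp only [map_add, map_sub, map_pow, MvPolynomial.aeval_X, map_one]
      exact (sexticHalf_den_pos (x 0)).ne'
    · simp [hφ]
  · -- injective on `(0,1)` (strictly increasing on `[0,1]`)
    intro p hp q hq h
    exact sextic_strictMonoOn_subst.injOn (Ioo_subset_Icc_self (hmem p hp))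
      (Ioo_subset_Icc_self (hmem q hq)) h
  · -- image `φ '' (0,1) = (0,1)`
    rw [hβd, hWd]
    exact (image_fin_one sextic_image_subst).symm
  · -- integrands
    intro p hp
    have hp' := hmem p hp
    have hφp : (fun _ : Fin 1 => φ (p 0)) ∈ β.domain := by
      rw [hβd]
      show φ (p 0) ∈ Ioo (0:ℝ) 1
      rw [← sextic_image_subst]
      exact mem_image_of_mem φ hp'
    have hpos : 0 < φ' (p 0) := by
      have h1 : 0 < p 0 := hp'.1
      have h2 : 0 < 1 - p 0 := by linarith [hp'.2]
      have h3 := sexticHalf_den_pos (p 0)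
      simp only [hφ']
      positivity
    rw [hWi hp, hβi hφp, abs_of_pos hpos]
    exact (sextic_subst_pullback hp').symm

end Summit.KontsevichZagierPeriods.FermatIsogeny.BetaLinearSector.Sixths

end
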